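import Summits.HodgeConjecture.CorCM.Census.OcticTwistResidualPrep
import Summits.HodgeConjecture.CorCM.Census.QuarticTwistGenerate

/-!
# The octic twist `(ℤ/8 × B, (4,0))`, XII: THE CLOSING MOVES (a) — six mixed classes give all the D-moves

COR-CM (cell `pub-hodgecm2`), count-neutral kernel combinatorics by the binder seat b09 (gen 33; lane COINVARIANT-TWIST / OCTIC RECON, design
step 4 = FACT 5 of `HOME/pub-hodgecm2-b09/lean-g33/COINVARIANT-TWIST.md`), on top of parts I–III, VI (`Census/OcticTwist{Model,Motion,Reduction,
ResidualPrep}.lean`: `tens`, `transl₂`, `transl₂_false_tens`, `transl₂_true_tens`) and the quartic files (`QuarticTwistModel`: `transl_single`,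
`tw_cst`, `tw_atom`, `transl_zero`; `QuarticTwistGenerate`: `sub_neg_add_self`) BY NAME.  Theorems only; no definition, no certificate, no named
fact, no `sorry`.  HONEST FRAMING: `HC_CM` is NOT proved; nothing here is a period or a headline.

WHAT.  Let `N₂` be MOTION-STABLE (`transl₂ e h N₂ ⊆ N₂`).  The octic residual theorem (part IX) wants, among six families, ALL the D-moves
`(e_a − e_u) ⊗ (e_{u′} − e_{u″})` and `(e_{u′} − e_{u″}) ⊗ (e_a − e_u)` (`a = u + kδ_b` a `±1`-atom of the regime `u`).  They follow from SIX classes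
`hF1`: `(e_0 − e_1) ⊗ (e_Δ − e_{Δ + k δ_{b₁}})`, `Δ ∈ {0,1,2}`, `k = ±1` — the exact residual reductions of the six MIXED closing faces of the octic
design.  §1 bookkeeping (translates of unit vectors; the diagonal motion and the swap-twist `v ⊗ w ↦ ((1,0)·w) ⊗ v` on outer products; the four
consecutive differences of constants sum to `0`; telescoping).  §2 `consecutive_mem`: motions give the classes `(e_u − e_{u+1}) ⊗ (e_{u′} − e_a)` with
`u′ − u ∈ {0,1,2}` and the fourth is minus the sum of the other three; `D1_mem` by telescoping; `D0_mem` by the swap-twist.  Part XII (b)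
(`Census/OcticTwistClosingMoves.lean`) adds the X- and Weil lifts from three more classes.

## References
* [Pohlmann1968] H. Pohlmann, Algebraic cycles on abelian varieties of complex multiplication type, Ann. of Math. 88 (1968), Thm 1.
-/

namespace Summit.HodgeConjecture.CorCM.Census.OcticTwist

open Finset
open Summit.HodgeConjecture.CorCM.Census.QuarticTwist

variable (B : Type) [AddGroup B] [Fintype B] [DecidableEq B]

/-! ## §1 Bookkeeping: translates of unit vectors, the two motions on outer products, vanishing sums -/

omit [DecidableEq B] in
/-- Diagonal translate of a unit vector at a constant type. [folklore] -/
theorem transl_single_cst (v : ZMod 4) (c : B) (u : ZMod 4) :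
    transl B (v, c) (Pi.single (cst B u) 1) = Pi.single (cst B (u + v)) 1 := by
  rw [transl_single, tw_cst]

/-- Diagonal translate of a unit vector at an atom. [folklore] -/
theorem transl_single_atom (v : ZMod 4) (c : B) (u : ZMod 4) (b : B) (k : ZMod 4) :
    transl B (v, c) (Pi.single (atom B u b k) 1) = Pi.single (atom B (u + v) (b - c) k) 1 := by
  rw [transl_single, tw_atom]

omit [Fintype B] [DecidableEq B] in
/-- A motion-stable submodule is stable under the diagonal translation of outer products. [folklore] -/
theorem diag_mem {N₂ : Submodule ℤ (Ty₂ B → ℤ)} (hmot : ∀ v ∈ N₂, ∀ (e : Bool) (h : ZMod 4 × B), transl₂ B e h v ∈ N₂)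
    {v w : Ty B → ℤ} (h : tens B v w ∈ N₂) (g : ZMod 4 × B) : tens B (transl B g v) (transl B g w) ∈ N₂ := by
  have := hmot _ h false g
  rwa [transl₂_false_tens] at this

omit [Fintype B] [DecidableEq B] in
/-- A motion-stable submodule is stable under the swap-twist of outer products: `v ⊗ w ↦ ((1,0)·w) ⊗ v`. [folklore] -/
theorem swap_mem {N₂ : Submodule ℤ (Ty₂ B → ℤ)} (hmot : ∀ v ∈ N₂, ∀ (e : Bool) (h : ZMod 4 × B), transl₂ B e h v ∈ N₂)
    {v w : Ty B → ℤ} (h : tens B v w ∈ N₂) : tens B (transl B (1, 0) w) v ∈ N₂ := by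
  have := hmot _ h true 0
  rwa [transl₂_true_tens, zero_add, transl_zero] at this

omit [AddGroup B] [Fintype B] [DecidableEq B] in
/-- `0 ⊗ w = 0`. [folklore] -/
theorem tens_zero_left (w : Ty B → ℤ) : tens B 0 w = 0 := by
  funext T
  show (0 : ℤ) * w T.2 = 0
  rw [zero_mul]

omit [AddGroup B] [Fintype B] [DecidableEq B] in
/-- `v ⊗ 0 = 0`. [folklore] -/
theorem tens_zero_right (v : Ty B → ℤ) : tens B v 0 = 0 := by
  funext T
  show v T.1 * (0 : ℤ) = 0
  rw [mul_zero]

omit [AddGroup B] [DecidableEq B] in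
/-- The four consecutive differences of constants sum to zero (first factor). [folklore] -/
theorem four_cycle_left (u : ZMod 4) (w : Ty B → ℤ) :
    tens B (Pi.single (cst B u) 1 - Pi.single (cst B (u + 1)) 1) w + tens B (Pi.single (cst B (u + 1)) 1 - Pi.single (cst B (u + 2)) 1) w
      + tens B (Pi.single (cst B (u + 2)) 1 - Pi.single (cst B (u + 3)) 1) w + tens B (Pi.single (cst B (u + 3)) 1 - Pi.single (cst B u) 1) w = 0 := by
  rw [← tens_add_left, ← tens_add_left, ← tens_add_left]
  have e : (Pi.single (cst B u) 1 - Pi.single (cst B (u + 1)) 1 + (Pi.single (cst B (u + 1)) 1 - Pi.single (cst B (u + 2)) 1)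
      + (Pi.single (cst B (u + 2)) 1 - Pi.single (cst B (u + 3)) 1) + (Pi.single (cst B (u + 3)) 1 - Pi.single (cst B u) 1) : Ty B → ℤ) = 0 := by
    abel
  rw [e, tens_zero_left]

omit [AddGroup B] [DecidableEq B] in
/-- Telescoping in the first factor: consecutive classes give all differences of constants. [folklore] -/
theorem tele_left {N₂ : Submodule ℤ (Ty₂ B → ℤ)} {w : Ty B → ℤ}
    (h : ∀ a : ZMod 4, tens B (Pi.single (cst B a) 1 - Pi.single (cst B (a + 1)) 1) w ∈ N₂) (u' u'' : ZMod 4) :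
    tens B (Pi.single (cst B u') 1 - Pi.single (cst B u'') 1) w ∈ N₂ := by
  have key : ∀ n : ℕ, tens B (Pi.single (cst B u') 1 - Pi.single (cst B (u' + n)) 1) w ∈ N₂ := by
    intro n
    induction n with
    | zero => rw [Nat.cast_zero, add_zero, sub_self, tens_zero_left]; exact Submodule.zero_mem _
    | succ n ih =>
      have e : (Pi.single (cst B u') 1 - Pi.single (cst B (u' + ((n + 1 : ℕ) : ZMod 4))) 1 : Ty B → ℤ)
          = (Pi.single (cst B u') 1 - Pi.single (cst B (u' + n)) 1) + (Pi.single (cst B (u' + n)) 1 - Pi.single (cst B (u' + n + 1)) 1) := by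
        rw [Nat.cast_succ, ← add_assoc, sub_add_sub_cancel]
      rw [e, tens_add_left]
      exact Submodule.add_mem _ ih (h (u' + n))
  have := key (u'' - u').val
  rwa [ZMod.natCast_zmod_val, add_sub_cancel] at this

omit [AddGroup B] [DecidableEq B] in
/-- Telescoping in the second factor. [folklore] -/
theorem tele_right {N₂ : Submodule ℤ (Ty₂ B → ℤ)} {v : Ty B → ℤ}
    (h : ∀ a : ZMod 4, tens B v (Pi.single (cst B a) 1 - Pi.single (cst B (a + 1)) 1) ∈ N₂) (u' u'' : ZMod 4) :
    tens B v (Pi.single (cst B u') 1 - Pi.single (cst B u'') 1) ∈ N₂ := by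
  have key : ∀ n : ℕ, tens B v (Pi.single (cst B u') 1 - Pi.single (cst B (u' + n)) 1) ∈ N₂ := by
    intro n
    induction n with
    | zero => rw [Nat.cast_zero, add_zero, sub_self, tens_zero_right]; exact Submodule.zero_mem _
    | succ n ih =>
      have e : (Pi.single (cst B u') 1 - Pi.single (cst B (u' + ((n + 1 : ℕ) : ZMod 4))) 1 : Ty B → ℤ)
          = (Pi.single (cst B u') 1 - Pi.single (cst B (u' + n)) 1) + (Pi.single (cst B (u' + n)) 1 - Pi.single (cst B (u' + n + 1)) 1) := by
        rw [Nat.cast_succ, ← add_assoc, sub_add_sub_cancel]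
      rw [e, tens_add_right]
      exact Submodule.add_mem _ ih (h (u' + n))
  have := key (u'' - u').val
  rwa [ZMod.natCast_zmod_val, add_sub_cancel] at this

/-! ## §2 The D-moves from the six mixed classes -/

/-- **All consecutive D-classes** `(e_u − e_{u+1}) ⊗ (e_{u′} − e_{u′ + k δ_b})` from the six classes of `hF1`: motions give `u′ − u ∈ {0,1,2}`, and the
class with `u′ − u = 3` is minus the sum of the other three. [folklore] -/
theorem consecutive_mem {N₂ : Submodule ℤ (Ty₂ B → ℤ)} (hmot : ∀ v ∈ N₂, ∀ (e : Bool) (h : ZMod 4 × B), transl₂ B e h v ∈ N₂) {b₁ : B}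
    (hF1 : ∀ Δ k : ZMod 4, (Δ = 0 ∨ Δ = 1 ∨ Δ = 2) → (k = 1 ∨ k = -1) →
      tens B (Pi.single (cst B 0) 1 - Pi.single (cst B 1) 1) (Pi.single (cst B Δ) 1 - Pi.single (atom B Δ b₁ k) 1) ∈ N₂)
    (u Δ : ZMod 4) (b : B) {k : ZMod 4} (hk : k = 1 ∨ k = -1) :
    tens B (Pi.single (cst B u) 1 - Pi.single (cst B (u + 1)) 1) (Pi.single (cst B (Δ + u)) 1 - Pi.single (atom B (Δ + u) b k) 1) ∈ N₂ := by
  -- the three direct classes, at every position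
  have key : ∀ u Δ : ZMod 4, (Δ = 0 ∨ Δ = 1 ∨ Δ = 2) →
      tens B (Pi.single (cst B u) 1 - Pi.single (cst B (u + 1)) 1) (Pi.single (cst B (Δ + u)) 1 - Pi.single (atom B (Δ + u) b k) 1) ∈ N₂ := by
    intro u Δ hΔ
    have h := diag_mem B hmot (hF1 Δ k hΔ hk) (u, -b + b₁)
    rw [transl_sub, transl_sub, transl_single_cst, transl_single_cst, transl_single_cst, transl_single_atom, zero_add, add_comm 1 u,
      sub_neg_add_self] at h
    exact h
  rcases (by decide : ∀ Δ : ZMod 4, Δ = 0 ∨ Δ = 1 ∨ Δ = 2 ∨ Δ = 3) Δ with h | h | h | h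
  · exact key u Δ (Or.inl h)
  · exact key u Δ (Or.inr (Or.inl h))
  · exact key u Δ (Or.inr (Or.inr h))
  · subst h
    rw [add_comm 3 u]
    have h1 := key (u + 1) 2 (Or.inr (Or.inr rfl))
    have h2 := key (u + 2) 1 (Or.inr (Or.inl rfl))
    have h3 := key (u + 3) 0 (Or.inl rfl)
    have e41 : u + 3 + 1 = u := by rw [add_assoc, show (3 : ZMod 4) + 1 = 0 by decide, add_zero]
    rw [show (2 : ZMod 4) + (u + 1) = u + 3 by ring, show u + 1 + 1 = u + 2 by ring] at h1
    rw [show (1 : ZMod 4) + (u + 2) = u + 3 by ring, show u + 2 + 1 = u + 3 by ring] at h2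
    rw [zero_add, e41] at h3
    have cyc := four_cycle_left B u (Pi.single (cst B (u + 3)) 1 - Pi.single (atom B (u + 3) b k) 1)
    rw [add_assoc, add_assoc] at cyc
    rw [eq_neg_of_add_eq_zero_left cyc]
    exact Submodule.neg_mem _ (Submodule.add_mem _ h1 (Submodule.add_mem _ h2 h3))

/-- **All D-moves of the second kind** `(e_{u′} − e_{u″}) ⊗ (e_a − e_u)` (`a = u + k δ_b`, `k = ±1`). [folklore] -/
theorem D1_mem {N₂ : Submodule ℤ (Ty₂ B → ℤ)} (hmot : ∀ v ∈ N₂, ∀ (e : Bool) (h : ZMod 4 × B), transl₂ B e h v ∈ N₂) {b₁ : B}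
    (hF1 : ∀ Δ k : ZMod 4, (Δ = 0 ∨ Δ = 1 ∨ Δ = 2) → (k = 1 ∨ k = -1) →
      tens B (Pi.single (cst B 0) 1 - Pi.single (cst B 1) 1) (Pi.single (cst B Δ) 1 - Pi.single (atom B Δ b₁ k) 1) ∈ N₂)
    (u : ZMod 4) (b : B) (k : ZMod 4) (u' u'' : ZMod 4) (hk : k = 1 ∨ k = -1) :
    tens B (Pi.single (cst B u') 1 - Pi.single (cst B u'') 1) (Pi.single (atom B u b k) 1 - Pi.single (cst B u) 1) ∈ N₂ := by
  have hcons : ∀ a : ZMod 4,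
      tens B (Pi.single (cst B a) 1 - Pi.single (cst B (a + 1)) 1) (Pi.single (cst B u) 1 - Pi.single (atom B u b k) 1) ∈ N₂ := by
    intro a
    have := consecutive_mem B hmot hF1 a (u - a) b hk
    rwa [sub_add_cancel] at this
  have h := tele_left B hcons u' u''
  have e : tens B (Pi.single (cst B u') 1 - Pi.single (cst B u'') 1) (Pi.single (atom B u b k) 1 - Pi.single (cst B u) 1)
      = -tens B (Pi.single (cst B u') 1 - Pi.single (cst B u'') 1) (Pi.single (cst B u) 1 - Pi.single (atom B u b k) 1) := by
    rw [tens_sub_right, tens_sub_right, neg_sub]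
  rw [e]
  exact Submodule.neg_mem _ h

/-- **All D-moves of the first kind** `(e_a − e_u) ⊗ (e_{u′} − e_{u″})`, by the swap-twist. [folklore] -/
theorem D0_mem {N₂ : Submodule ℤ (Ty₂ B → ℤ)} (hmot : ∀ v ∈ N₂, ∀ (e : Bool) (h : ZMod 4 × B), transl₂ B e h v ∈ N₂) {b₁ : B}
    (hF1 : ∀ Δ k : ZMod 4, (Δ = 0 ∨ Δ = 1 ∨ Δ = 2) → (k = 1 ∨ k = -1) →
      tens B (Pi.single (cst B 0) 1 - Pi.single (cst B 1) 1) (Pi.single (cst B Δ) 1 - Pi.single (atom B Δ b₁ k) 1) ∈ N₂)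
    (u : ZMod 4) (b : B) (k : ZMod 4) (u' u'' : ZMod 4) (hk : k = 1 ∨ k = -1) :
    tens B (Pi.single (atom B u b k) 1 - Pi.single (cst B u) 1) (Pi.single (cst B u') 1 - Pi.single (cst B u'') 1) ∈ N₂ := by
  have h := swap_mem B hmot (D1_mem B hmot hF1 (u - 1) b k u' u'' hk)
  rwa [transl_sub, transl_single_atom, transl_single_cst, sub_add_cancel, sub_zero] at h

end Summit.HodgeConjecture.CorCM.Census.OcticTwist
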